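import Literature.AlgebraicGeometry.Frobenioids.Prop53Sub
import Literature.AlgebraicGeometry.Frobenioids.RealificationMonoidOn

/-!
# Frobenioids I, Prop. 5.3 / Cor. 5.4 sub-DAG (W3): slot binders for rows P53/L02a, P53/L02c and the PROOF
# of row C54/L02 (`Ψ^Φ` realifies) — proof companion of `Prop53Sub.lean`

Mochizuki, *The geometry of Frobenioids I: the general theory*, Kyushu J. Math. **62** (2008) 293–400,
§5, Proposition 5.3 p. 103 ("the divisor monoid `Φ^rlf`", "the rational function monoid `ℝ · Φ^birat`") and
Corollary 5.4 p. 104 [cite: MochizukiFrdI2008, Prop. 5.3 p.103] [cite: MochizukiFrdI2008, Cor. 5.4 p.104].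

Cell abc-iut, L1 sub-DAG W3 (seat abc-iut-w5-d137), rows of `SUBDAG-FrdI-Prop53-Cor54.md`:

* slots **P53/L02a** `FrdI.Prop53Sub.isMonoidOnRlf_holds` (`Φ^rlf` is a monoid on `D` under divisibility-
  reflecting pull-backs) and `rlfMapInjectiveOfReflects_holds`, **P53/L02c** `isMonoidOnRealSpan_holds`
  (`ℝ · Ψ` is a monoid on `D`) — bound to the theorems of `RealificationMonoidOn.lean`;
* **P53/L02d (iso case)** `GpSubfunctor.isFSMSurjective_of_isIso`: over a base whose FSM-morphisms are
  isomorphisms every subfunctor of groups (so `Φ^birat`) is FSM-surjective;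
* (**C54/L04** `realSpanCompat_holds` is seat abc-iut-w5-d097's `Cor54SubRealSpanCompatProofs.lean`, L1-lead R97 (6));
* **C54/L09** `FrdI.Cor54Sub.compatProp53_of_square`: the final clause of Cor. 5.4 as typed (`CompatProp53`) follows
  from `Square` and the Thm. 3.4 (iii) square by iso pasting alone (whiskering) — as the slot's docstring says, it
  carries no content beyond those inputs (audit F-t10g3-2, seat abc-iut-L1-t10);
* **C54/L02** `FrdI.Cor54Sub.rlfIso` / `rlfMonoidIso_holds`: an isomorphism of divisor monoids `Ψ^Φ : Φ₁ ⥲ Φ₂`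
  over `Ψ^Base` (the data `DivisorMonoidIsoOverBase` of Cor. 4.11 (iii)) realifies to `Φ₁^rlf ⥲ Φ₂^rlf` over
  `Ψ^Base`, natural in the pull-backs and compatible with `Φ_i → Φ_i^rlf` — functoriality of `f ↦ f^rlf`
  (`IsPerfFactorial.Rlf.map`, `map_id'`, `map_comp'`, `map_toRealification_of`, seat abc-iut-L1-d2).  The
  construction `rlfIso` is DATA (the realified isomorphism), used by rows C54/L04–L05;
* (**C54/L05**, the model-level `Ψ^rlf` as an equivalence — `FrdI.Cor54Sub.rlfTransport_holds` — is the sibling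
  file `Cor54SubTransportProofs.lean`, over `ModelFrobenioidBaseChangeEquivalence.lean`.)

Standard axioms only; nothing here bears on [IUTchIII] Cor. 3.12.
-/

noncomputable section

namespace Literature.AlgebraicGeometry.Frobenioids

open CategoryTheory Opposite Function Literature.AnabelianGeometry.EtaleTheta

universe w v v' u u' v₁ v₁' u₁ u₁' v₂ v₂' u₂ u₂'

/-! ### Slot binders for rows P53/L02a, P53/L02c -/

namespace FrdI.Prop53Sub

variable {D : Type u} [Category.{v} D] {Φ : Dᵒᵖ ⥤ CommMonCat.{w}}

/-- **P53/L02a (monoid-theoretic core, divisibility-reflection form), PROVED.**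
[cite: MochizukiFrdI2008, Def. 2.4 (i) p.48] -/
theorem rlfMapInjectiveOfReflects_holds : RlfMapInjectiveOfReflects.{w} :=
  fun _ _ _ _ hM hN f hinj hrefl => IsPerfFactorial.Rlf.map_injective_of_reflects hM hN f hinj hrefl

/-- **P53/L02a, PROVED**: `Φ^rlf` is a monoid on `D` for a perf-factorial monoid `Φ` on `D` whose pull-backs
reflect divisibility (`isMonoidOn_rlfFunctor_of_reflects`). [cite: MochizukiFrdI2008, Prop. 5.3 p.103] -/
theorem isMonoidOnRlf_holds (hΦ : ∀ X : Dᵒᵖ, IsPerfFactorial (Φ.obj X)) : IsMonoidOnRlf Φ hΦ :=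
  fun hM hrefl => isMonoidOn_rlfFunctor_of_reflects hΦ hM hrefl

/-- **P53/L02c, PROVED**: `ℝ · Ψ` is a monoid on `D` (`RealificationData.isMonoidOn_realSpan`).
[cite: MochizukiFrdI2008, Prop. 5.3 p.103] -/
theorem isMonoidOnRealSpan_holds (R : RealificationData Φ) (Ψ : GpSubfunctor Φ) :
    IsMonoidOnRealSpan R Ψ :=
  fun hR hint hΨ => R.isMonoidOn_realSpan Ψ hR hint hΨ

end FrdI.Prop53Sub

/-! ### P53/L02d, the easy case: FSM-morphisms that are isomorphisms -/

namespace GpSubfunctor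

variable {D : Type u} [Category.{v} D] {Φ : Dᵒᵖ ⥤ CommMonCat.{w}} (Ψ : GpSubfunctor Φ)

/-- Any subfunctor of groups is FSM-surjective over a base category whose FSM-morphisms are isomorphisms
(preimage along `α⁻¹`, by stability under pull-back). [cite: MochizukiFrdI2008, Def. 1.1 (ii) p.19] -/
theorem isFSMSurjective_of_isIso (hD : ∀ ⦃X Y : D⦄ (α : X ⟶ Y), IsFSM α → IsIso α) :
    Ψ.IsFSMSurjective := by
  intro X Y α hα c hc
  haveI := hD α hα
  refine ⟨pullGp Φ (inv α) c, Ψ.pull_mem (inv α) hc, ?_⟩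
  rw [← pullGp_comp, IsIso.hom_inv_id, pullGp_id]

end GpSubfunctor

/-! ### C54/L02: `Ψ^Φ` realifies -/

/-- `e⁻¹ ∘ e = id` for a multiplicative equivalence, as monoid homomorphisms. [folklore] -/
private theorem mulEquiv_symm_comp_toMonoidHom' {M N : Type w} [CommMonoid M] [CommMonoid N] (e : M ≃* N) :
    e.symm.toMonoidHom.comp e.toMonoidHom = MonoidHom.id M :=
  MonoidHom.ext fun x => e.symm_apply_apply x

/-- `e ∘ e⁻¹ = id` for a multiplicative equivalence, as monoid homomorphisms. [folklore] -/
private theorem mulEquiv_self_comp_symm_toMonoidHom' {M N : Type w} [CommMonoid M] [CommMonoid N]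
    (e : M ≃* N) : e.toMonoidHom.comp e.symm.toMonoidHom = MonoidHom.id N :=
  MonoidHom.ext fun y => e.apply_symm_apply y

namespace FrdI.Cor54Sub

variable {D₁ : Type u₁'} [Category.{v₁'} D₁] {Φ₁ : D₁ᵒᵖ ⥤ CommMonCat.{w}}
  {C₁ : Type u₁} [Category.{v₁} C₁] (F₁ : C₁ ⥤ ElemFrobenioid Φ₁) (hΦ₁ : PreFrobenioid.IsPerfFactorialOn Φ₁)
  {D₂ : Type u₂'} [Category.{v₂'} D₂] {Φ₂ : D₂ᵒᵖ ⥤ CommMonCat.{w}}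
  {C₂ : Type u₂} [Category.{v₂} C₂] (F₂ : C₂ ⥤ ElemFrobenioid Φ₂) (hΦ₂ : PreFrobenioid.IsPerfFactorialOn Φ₂)

/-- The component of `Ψ^Φ` at `X`, as an isomorphism of the underlying monoids `Φ₁(X) ≃ Φ₂(Ψ^Base X)` (the
operations `Mon` of `PreFrobenioidData.ofFunctor` ARE the `Φ_i(X)`). [cite: MochizukiFrdI2008, Cor. 4.11 (iii) p.92] -/
abbrev isoAt {ΨBase : D₁ ⥤ D₂}
    (E : PreFrobenioidData.DivisorMonoidIsoOverBase
      (PreFrobenioidData.ofFunctor Φ₁ F₁) (PreFrobenioidData.ofFunctor Φ₂ F₂) ΨBase) (X : D₁) :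
    Φ₁.obj (op X) ≃* Φ₂.obj (op (ΨBase.obj X)) :=
  E.iso X

/-- `(Ψ^Φ)^rlf` at `X` as a homomorphism: `f ↦ f^rlf` applied to the component at `X`.
[cite: MochizukiFrdI2008, Cor. 5.4 p.104] -/
abbrev rlfMapAt {ΨBase : D₁ ⥤ D₂}
    (E : PreFrobenioidData.DivisorMonoidIsoOverBase
      (PreFrobenioidData.ofFunctor Φ₁ F₁) (PreFrobenioidData.ofFunctor Φ₂ F₂) ΨBase) (X : D₁) :
    (PreFrobenioid.IsPerfFactorialOn.op hΦ₁ (op X)).Rlf →*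
      (PreFrobenioid.IsPerfFactorialOn.op hΦ₂ (op (ΨBase.obj X))).Rlf :=
  IsPerfFactorial.Rlf.map _ _ (isoAt F₁ F₂ E X).toMonoidHom

/-- Its inverse: `f ↦ f^rlf` applied to the inverse component. [cite: MochizukiFrdI2008, Cor. 5.4 p.104] -/
abbrev rlfMapInvAt {ΨBase : D₁ ⥤ D₂}
    (E : PreFrobenioidData.DivisorMonoidIsoOverBase
      (PreFrobenioidData.ofFunctor Φ₁ F₁) (PreFrobenioidData.ofFunctor Φ₂ F₂) ΨBase) (X : D₁) :
    (PreFrobenioid.IsPerfFactorialOn.op hΦ₂ (op (ΨBase.obj X))).Rlf →*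
      (PreFrobenioid.IsPerfFactorialOn.op hΦ₁ (op X)).Rlf :=
  IsPerfFactorial.Rlf.map _ _ (isoAt F₁ F₂ E X).symm.toMonoidHom

/-- `((Ψ^Φ_X)⁻¹)^rlf ∘ (Ψ^Φ_X)^rlf = id`. [cite: MochizukiFrdI2008, Cor. 5.4 p.104] -/
theorem rlfMapInvAt_comp {ΨBase : D₁ ⥤ D₂}
    (E : PreFrobenioidData.DivisorMonoidIsoOverBase
      (PreFrobenioidData.ofFunctor Φ₁ F₁) (PreFrobenioidData.ofFunctor Φ₂ F₂) ΨBase) (X : D₁) :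
    (rlfMapInvAt F₁ hΦ₁ F₂ hΦ₂ E X).comp (rlfMapAt F₁ hΦ₁ F₂ hΦ₂ E X) = MonoidHom.id _ := by
  rw [rlfMapAt, rlfMapInvAt, ← IsPerfFactorial.Rlf.map_comp', mulEquiv_symm_comp_toMonoidHom',
    IsPerfFactorial.Rlf.map_id']

/-- `(Ψ^Φ_X)^rlf ∘ ((Ψ^Φ_X)⁻¹)^rlf = id`. [cite: MochizukiFrdI2008, Cor. 5.4 p.104] -/
theorem rlfMapAt_comp_inv {ΨBase : D₁ ⥤ D₂}
    (E : PreFrobenioidData.DivisorMonoidIsoOverBase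
      (PreFrobenioidData.ofFunctor Φ₁ F₁) (PreFrobenioidData.ofFunctor Φ₂ F₂) ΨBase) (X : D₁) :
    (rlfMapAt F₁ hΦ₁ F₂ hΦ₂ E X).comp (rlfMapInvAt F₁ hΦ₁ F₂ hΦ₂ E X) = MonoidHom.id _ := by
  rw [rlfMapAt, rlfMapInvAt, ← IsPerfFactorial.Rlf.map_comp', mulEquiv_self_comp_symm_toMonoidHom',
    IsPerfFactorial.Rlf.map_id']

/-- `(Ψ^Φ)^rlf` at `X`: the realification of the component `Φ₁(X) ≃ Φ₂(Ψ^Base X)` — `f ↦ f^rlf` applied to the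
isomorphism and its inverse (`map_comp'`, `map_id'`). [cite: MochizukiFrdI2008, Cor. 5.4 p.104] -/
def rlfIsoAt {ΨBase : D₁ ⥤ D₂}
    (E : PreFrobenioidData.DivisorMonoidIsoOverBase
      (PreFrobenioidData.ofFunctor Φ₁ F₁) (PreFrobenioidData.ofFunctor Φ₂ F₂) ΨBase) (X : D₁) :
    (PreFrobenioid.IsPerfFactorialOn.op hΦ₁ (op X)).Rlf ≃*
      (PreFrobenioid.IsPerfFactorialOn.op hΦ₂ (op (ΨBase.obj X))).Rlf :=
  MonoidHom.toMulEquiv (rlfMapAt F₁ hΦ₁ F₂ hΦ₂ E X) (rlfMapInvAt F₁ hΦ₁ F₂ hΦ₂ E X)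
    (rlfMapInvAt_comp F₁ hΦ₁ F₂ hΦ₂ E X) (rlfMapAt_comp_inv F₁ hΦ₁ F₂ hΦ₂ E X)

/-- Naturality of `(Ψ^Φ)^rlf` in the pull-backs, at the level of homomorphisms: `(Ψ^Φ_Y)^rlf ∘ (Φ₁(f))^rlf =
(Φ₂(Ψ^Base f))^rlf ∘ (Ψ^Φ_X)^rlf` (functoriality of `f ↦ f^rlf` + naturality of `Ψ^Φ`).
[cite: MochizukiFrdI2008, Cor. 5.4 p.104] -/
theorem rlfMapAt_natural {ΨBase : D₁ ⥤ D₂}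
    (E : PreFrobenioidData.DivisorMonoidIsoOverBase
      (PreFrobenioidData.ofFunctor Φ₁ F₁) (PreFrobenioidData.ofFunctor Φ₂ F₂) ΨBase) {X Y : D₁} (f : Y ⟶ X) :
    (rlfMapAt F₁ hΦ₁ F₂ hΦ₂ E Y).comp
        (IsPerfFactorial.Rlf.map (PreFrobenioid.IsPerfFactorialOn.op hΦ₁ (op X))
          (PreFrobenioid.IsPerfFactorialOn.op hΦ₁ (op Y)) (Φ₁.map f.op).hom) =
      (IsPerfFactorial.Rlf.map (PreFrobenioid.IsPerfFactorialOn.op hΦ₂ (op (ΨBase.obj X)))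
          (PreFrobenioid.IsPerfFactorialOn.op hΦ₂ (op (ΨBase.obj Y))) (Φ₂.map (ΨBase.map f).op).hom).comp
        (rlfMapAt F₁ hΦ₁ F₂ hΦ₂ E X) := by
  rw [rlfMapAt, rlfMapAt, ← IsPerfFactorial.Rlf.map_comp', ← IsPerfFactorial.Rlf.map_comp']
  congr 1
  ext y
  exact E.natural f y

/-- **`(Ψ^Φ)^rlf`**: the realified isomorphism of divisor monoids over `Ψ^Base` (natural in pull-backs: the
pull-backs of `Φ^rlf` are the `(Φ(f))^rlf`, `rlfMap_eq_map`, and `f ↦ f^rlf` is functorial).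
[cite: MochizukiFrdI2008, Cor. 5.4 p.104] -/
def rlfIso {ΨBase : D₁ ⥤ D₂}
    (E : PreFrobenioidData.DivisorMonoidIsoOverBase
      (PreFrobenioidData.ofFunctor Φ₁ F₁) (PreFrobenioidData.ofFunctor Φ₂ F₂) ΨBase) :
    PreFrobenioidData.DivisorMonoidIsoOverBase (rlfData F₁ hΦ₁) (rlfData F₂ hΦ₂) ΨBase where
  iso := rlfIsoAt F₁ hΦ₁ F₂ hΦ₂ E
  natural := by
    intro X Y f x
    change rlfMapAt F₁ hΦ₁ F₂ hΦ₂ E Y (rlfMap Φ₁ (PreFrobenioid.IsPerfFactorialOn.op hΦ₁) f.op x) =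
      rlfMap Φ₂ (PreFrobenioid.IsPerfFactorialOn.op hΦ₂) (ΨBase.map f).op (rlfMapAt F₁ hΦ₁ F₂ hΦ₂ E X x)
    rw [IsPerfFactorial.Rlf.rlfMap_eq_map, IsPerfFactorial.Rlf.rlfMap_eq_map]
    exact DFunLike.congr_fun (rlfMapAt_natural F₁ hΦ₁ F₂ hΦ₂ E f) x

/-- `(Ψ^Φ)^rlf` extends `Ψ^Φ` along `Φ_i → Φ_i^rlf`. [cite: MochizukiFrdI2008, Cor. 5.4 p.104] -/
theorem rlfIso_toRlf {ΨBase : D₁ ⥤ D₂}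
    (E : PreFrobenioidData.DivisorMonoidIsoOverBase
      (PreFrobenioidData.ofFunctor Φ₁ F₁) (PreFrobenioidData.ofFunctor Φ₂ F₂) ΨBase)
    (X : D₁) (x : Φ₁.obj (op X)) :
    (rlfIso F₁ hΦ₁ F₂ hΦ₂ E).iso X
        (((toRlfNatTrans Φ₁ (PreFrobenioid.IsPerfFactorialOn.op hΦ₁)).app (op X)).hom x) =
      ((toRlfNatTrans Φ₂ (PreFrobenioid.IsPerfFactorialOn.op hΦ₂)).app (op (ΨBase.obj X))).hom
        (E.iso X x) :=
  IsPerfFactorial.Rlf.map_toRealification_of _ _ (E.iso X).toMonoidHom x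

/-- **C54/L02, PROVED**: `Ψ^Φ` realifies, compatibly with `Φ_i → Φ_i^rlf`. [cite: MochizukiFrdI2008, Cor. 5.4 p.104] -/
theorem rlfMonoidIso_holds (ΨBase : D₁ ⥤ D₂) : RlfMonoidIso F₁ hΦ₁ F₂ hΦ₂ ΨBase :=
  fun E => ⟨rlfIso F₁ hΦ₁ F₂ hΦ₂ E, rlfIso_toRlf F₁ hΦ₁ F₂ hΦ₂ E⟩


/-! ### C54/L09: the compatibility with the Prop. 5.3 diagram is iso pasting -/

section Compat

variable {F₁ F₂}
variable (Ψistr : (PreFrobenioidData.ofFunctor Φ₁ F₁).Istr ⥤ (PreFrobenioidData.ofFunctor Φ₂ F₂).Istr)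
  (e₁ : (PreFrobenioidData.ofFunctor Φ₁ F₁).Untr ≌ PreFrobenioid.untrModel F₁)
  (e₂ : (PreFrobenioidData.ofFunctor Φ₂ F₂).Untr ≌ PreFrobenioid.untrModel F₂)
  (Ψrlf : PreFrobenioid.rlf F₁ hΦ₁ ⥤ PreFrobenioid.rlf F₂ hΦ₂)

/-- **C54/L09, PROVED as typed**: "the formation of `Ψ^rlf` from `Ψ` is 1-compatible with the 1-commutative diagram
of Proposition 5.3" in the typed form `CompatProp53` — from the square of C54/L06 and the Thm. 3.4 (iii) square by
pasting natural isomorphisms (no further content; audit F-t10g3-2). [cite: MochizukiFrdI2008, Cor. 5.4 p.104] -/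
theorem compatProp53_of_square {P₁ : Type*} [Category P₁] {P₂ : Type*} [Category P₂]
    (toPf₁ : (PreFrobenioidData.ofFunctor Φ₁ F₁).Istr ⥤ P₁) (pfToRlf₁ : P₁ ⥤ PreFrobenioid.rlf F₁ hΦ₁)
    (toPf₂ : (PreFrobenioidData.ofFunctor Φ₂ F₂).Istr ⥤ P₂) (pfToRlf₂ : P₂ ⥤ PreFrobenioid.rlf F₂ hΦ₂)
    (Ψpf : P₁ ⥤ P₂) : CompatProp53 hΦ₁ hΦ₂ Ψistr e₁ e₂ Ψrlf toPf₁ pfToRlf₁ toPf₂ pfToRlf₂ Ψpf := by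
  rintro ⟨h₁⟩ ⟨h₂⟩ ⟨hpf⟩ ⟨hsq⟩
  refine ⟨?_⟩
  calc toPf₁ ⋙ (pfToRlf₁ ⋙ Ψrlf) ≅ (toPf₁ ⋙ pfToRlf₁) ⋙ Ψrlf := (Functor.associator _ _ _).symm
    _ ≅ FrdI.Prop53Sub.iotaRlf F₁ hΦ₁ e₁ ⋙ Ψrlf := Functor.isoWhiskerRight h₁ Ψrlf
    _ ≅ Ψistr ⋙ FrdI.Prop53Sub.iotaRlf F₂ hΦ₂ e₂ := hsq
    _ ≅ Ψistr ⋙ (toPf₂ ⋙ pfToRlf₂) := Functor.isoWhiskerLeft Ψistr h₂.symm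
    _ ≅ (Ψistr ⋙ toPf₂) ⋙ pfToRlf₂ := (Functor.associator _ _ _).symm
    _ ≅ (toPf₁ ⋙ Ψpf) ⋙ pfToRlf₂ := Functor.isoWhiskerRight hpf.symm pfToRlf₂
    _ ≅ toPf₁ ⋙ (Ψpf ⋙ pfToRlf₂) := Functor.associator _ _ _

end Compat

end FrdI.Cor54Sub

end Literature.AlgebraicGeometry.Frobenioids

end
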